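import Literature.InformationTheory.QuantumCodes.CSS
import HarnessLib

/-!
# Binary words as `𝔽₂`-vectors and row-list matrices
# (word layer of the CSS distance-certificate checker, plan/CERT-FORMAT.md v1)

The certificate checker `checkDistCert` (file `Census/CertCheck.lean`) computes with binary numerals: a vector of
`𝔽₂ⁿ` is a `Nat` whose bit `j` is coordinate `j` (`ofBits`), a check matrix is a `List ℕ` of such rows
(`rowMatrix`), weights are bit counts (`popc`), syndromes are XORs of column words (`colMask`), and the brute-force
lower bound is the include/skip enumeration `scan` of all supports of bounded weight carrying the syndrome
incrementally (file `Census/CertScan.lean`). This file is the word layer and its soundness lemmas: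
`hammingNorm_ofBits`, `ofBits_dotProduct`, `synZero_iff` (bit count = Hamming weight, AND-parity = dot product,
`synZero` = `H v = 0`), `ofBits_xorRows_mem_rowSpace` (a XOR of rows is in the row space), `testBit_colMask` /
`ofBits_colMask` (the column word is the matrix column). All folklore bit arithmetic; everything is structural
`List`/`Nat` recursion (kernel-reducible by `decide`), no well-founded recursion.
Matrices and row spaces are type-02/type-04's (`Literature.InformationTheory.QuantumCodes.{rowSpace, CSSCode}`).
-/

namespace Summit.Ventures.QEC.Census


open Matrix Literature.InformationTheory.QuantumCodes

/-! ## Binary words as vectors over `𝔽₂` -/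

/-- The vector of a binary numeral: `(ofBits n w) i = 1` if bit `i` of `w` is set, else `0` (`i < n`); bits `≥ n`
are ignored. (definition) -/
def ofBits (n w : ℕ) : Fin n → ZMod 2 := fun i => if w.testBit i then 1 else 0

/-- `popc n w` = the number of set bits of `w` among bits `0 … n−1`. (definition, structural on `n`) -/
def popc : ℕ → ℕ → ℕ
  | 0, _ => 0
  | n + 1, w => w % 2 + popc n (w / 2)

/-- XOR of a list of numerals. (definition) -/
def xorList : List ℕ → ℕ
  | [] => 0
  | a :: l => a ^^^ xorList l

/-- XOR of the rows `rows[i]`, `i ∈ sel` (out-of-range indices contribute `0`). (definition) -/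
def xorRows (rows : List ℕ) (sel : List ℕ) : ℕ := xorList (sel.map fun i => rows.getD i 0)

/-- The column mask of column `j` of the row list: bit `r` of `colMask rows j` = bit `j` of `rows[r]`.
(definition, structural on the list) -/
def colMask : List ℕ → ℕ → ℕ
  | [], _ => 0
  | h :: t, j => (if h.testBit j then 1 else 0) + 2 * colMask t j

/-- The binary matrix whose `i`-th row is the word `rows[i]` (columns `0 … n−1`). (definition) -/
def rowMatrix (n : ℕ) (rows : List ℕ) : Matrix (Fin rows.length) (Fin n) (ZMod 2) :=
  fun i j => ofBits n rows[i] j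

/-- `synZero n H v`: every row of `H` has even overlap with `v` on bits `< n`, i.e. `H v = 0`. (definition) -/
def synZero (n : ℕ) (H : List ℕ) (v : ℕ) : Bool := H.all fun h => popc n (h &&& v) % 2 == 0

/-! ## Soundness: bit words -/

section Bits

/-- The word of `0` is the zero vector. -/
theorem ofBits_zero (n : ℕ) : ofBits n 0 = 0 := by
  funext i; simp [ofBits]

/-- XOR of words is addition of vectors over `𝔽₂`. -/
theorem ofBits_xor (n a b : ℕ) : ofBits n (a ^^^ b) = ofBits n a + ofBits n b := by
  funext i
  simp only [ofBits, Nat.testBit_xor, Pi.add_apply]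
  cases a.testBit i <;> cases b.testBit i <;> decide

/-- The word of a XOR-fold is the sum of the words. -/
theorem ofBits_xorList (n : ℕ) (l : List ℕ) : ofBits n (xorList l) = (l.map (ofBits n)).sum := by
  induction l with
  | nil => exact ofBits_zero n
  | cons a l ih => rw [xorList, ofBits_xor, ih, List.map_cons, List.sum_cons]

/-- The word of `2^j` is the `j`-th basis vector. -/
theorem ofBits_two_pow (n j : ℕ) (hj : j < n) : ofBits n (2 ^ j) = Pi.single (⟨j, hj⟩ : Fin n) 1 := by
  funext i
  simp only [ofBits, Nat.testBit_two_pow]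
  by_cases h : j = (i : ℕ)
  · subst h
    simp
  · have : (⟨j, hj⟩ : Fin n) ≠ i := fun e => h (by rw [← e])
    simp [h, Pi.single_eq_of_ne' this]

/-- Coordinate `i` of a word is `1` iff bit `i` is set. -/
theorem ofBits_apply_eq_one_iff (n w : ℕ) (i : Fin n) : ofBits n w i = 1 ↔ w.testBit i = true := by
  unfold ofBits; split <;> simp_all

/-- Coordinate `i` of a word is nonzero iff bit `i` is set. -/
theorem ofBits_apply_ne_zero_iff (n w : ℕ) (i : Fin n) : ofBits n w i ≠ 0 ↔ w.testBit i = true := by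
  unfold ofBits; split <;> simp_all

/-- `popc n w = Σ_{i<n} bit i`. -/
theorem popc_eq_sum (n w : ℕ) : popc n w = ∑ i : Fin n, (w.testBit i).toNat := by
  induction n generalizing w with
  | zero => simp [popc]
  | succ n ih =>
    rw [popc, ih (w / 2), Fin.sum_univ_succ]
    simp only [Fin.val_zero, Fin.val_succ, Nat.testBit_succ, Nat.testBit_zero]
    rcases Nat.mod_two_eq_zero_or_one w with h | h <;> simp [h]

/-- The Hamming weight of the word of `w` is its bit count below `n`. -/
theorem hammingNorm_ofBits (n w : ℕ) : hammingNorm (ofBits n w) = popc n w := by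
  rw [hammingNorm, popc_eq_sum, Finset.card_filter]
  refine Finset.sum_congr rfl fun i _ => ?_
  by_cases h : w.testBit i = true
  · simp [(ofBits_apply_ne_zero_iff n w i).2 h, h]
  · have h' : ofBits n w i = 0 := by
      by_contra h''
      exact h ((ofBits_apply_ne_zero_iff n w i).1 h'')
    simp [h', Bool.eq_false_iff.mpr h]

/-- Dot product of two words = parity of the bit count of their AND. -/
theorem ofBits_dotProduct (n a b : ℕ) : ofBits n a ⬝ᵥ ofBits n b = (popc n (a &&& b) : ZMod 2) := by
  rw [dotProduct, popc_eq_sum, Nat.cast_sum]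
  refine Finset.sum_congr rfl fun i _ => ?_
  simp only [ofBits, Nat.testBit_and]
  rcases Bool.eq_false_or_eq_true (a.testBit i) with ha | ha <;>
    rcases Bool.eq_false_or_eq_true (b.testBit i) with hb | hb <;> simp [ha, hb]

/-- A natural number is `0` in `𝔽₂` iff it is even. -/
theorem natCast_zmod2_eq_zero_iff (m : ℕ) : (m : ZMod 2) = 0 ↔ m % 2 = 0 := by
  rw [ZMod.natCast_eq_zero_iff, Nat.dvd_iff_mod_eq_zero]

/-- A natural number is nonzero in `𝔽₂` iff it is odd. -/
theorem natCast_zmod2_ne_zero_iff (m : ℕ) : (m : ZMod 2) ≠ 0 ↔ m % 2 = 1 := by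
  rw [Ne, natCast_zmod2_eq_zero_iff]; omega

/-- `synZero n H v = true` iff `rowMatrix n H *ᵥ ofBits n v = 0`. -/
theorem synZero_iff (n : ℕ) (H : List ℕ) (v : ℕ) :
    synZero n H v = true ↔ rowMatrix n H *ᵥ ofBits n v = 0 := by
  simp only [synZero, List.all_eq_true, beq_iff_eq]
  constructor
  · intro h
    funext i
    rw [Pi.zero_apply, mulVec, show (fun j => rowMatrix n H i j) = ofBits n H[i] from rfl, ofBits_dotProduct,
      natCast_zmod2_eq_zero_iff]
    exact h _ (List.getElem_mem _)
  · intro h x hx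
    obtain ⟨i, hi, rfl⟩ := List.getElem_of_mem hx
    have := congrFun h ⟨i, hi⟩
    rw [Pi.zero_apply, mulVec, show (fun j => rowMatrix n H ⟨i, hi⟩ j) = ofBits n H[i] from rfl, ofBits_dotProduct,
      natCast_zmod2_eq_zero_iff] at this
    exact this

/-- A XOR of rows lies in the row space. -/
theorem ofBits_xorRows_mem_rowSpace (n : ℕ) (rows : List ℕ) (sel : List ℕ) :
    ofBits n (xorRows rows sel) ∈ rowSpace (rowMatrix n rows) := by
  rw [xorRows, ofBits_xorList, List.map_map]
  refine list_sum_mem ?_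
  intro x hx
  rw [List.mem_map] at hx
  obtain ⟨i, -, rfl⟩ := hx
  simp only [Function.comp_apply]
  by_cases hi : i < rows.length
  · have hget : rows.getD i 0 = rows[i] := by
      simp only [List.getD_eq_getElem?_getD, List.getElem?_eq_getElem hi, Option.getD_some]
    rw [hget]
    refine mem_rowSpace_of_vecMul_eq (Pi.single ⟨i, hi⟩ 1) ?_
    rw [Matrix.single_one_vecMul]
    rfl
  · have hget : rows.getD i 0 = 0 := by
      simp only [List.getD_eq_getElem?_getD, List.getElem?_eq_none (not_lt.mp hi), Option.getD_none]
    rw [hget, ofBits_zero]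
    exact Submodule.zero_mem _

end Bits

/-! ## Column words -/

section Columns

variable (n : ℕ) (H : List ℕ)

/-- bit `r` of `colMask rows j` is bit `j` of `rows[r]`. -/
theorem testBit_colMask (rows : List ℕ) (j r : ℕ) (hr : r < rows.length) :
    (colMask rows j).testBit r = rows[r].testBit j := by
  induction rows generalizing r with
  | nil => simp at hr
  | cons h t ih =>
    cases r with
    | zero =>
      rw [colMask, Nat.testBit_zero]
      split <;> simp_all [Nat.add_mul_mod_self_left]
    | succ r =>
      rw [colMask, Nat.testBit_succ]
      have hr' : r < t.length := by simpa using hr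
      have : ((if h.testBit j then 1 else 0) + 2 * colMask t j) / 2 = colMask t j := by
        split <;> omega
      rw [this, ih r hr']
      simp

/-- The column word has no bits at or above the number of rows. -/
theorem colMask_lt (rows : List ℕ) (j : ℕ) : colMask rows j < 2 ^ rows.length := by
  induction rows with
  | nil => simp [colMask]
  | cons h t ih =>
    rw [colMask, List.length_cons, Nat.pow_succ]
    split <;> omega

/-- XOR-folds stay below a common power of two. -/
theorem xorList_lt (m : ℕ) (l : List ℕ) (hl : ∀ x ∈ l, x < 2 ^ m) : xorList l < 2 ^ m := by
  induction l with
  | nil => simp [xorList]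
  | cons a l ih =>
    rw [xorList]
    exact Nat.xor_lt_two_pow (hl a (by simp)) (ih fun x hx => hl x (by simp [hx]))

/-- The column word of qubit `j`, read as a vector over the rows, is column `j` of the matrix. -/
theorem ofBits_colMask (j : ℕ) (hj : j < n) :
    ofBits H.length (colMask H j) = (rowMatrix n H).col ⟨j, hj⟩ := by
  funext r
  simp only [ofBits, rowMatrix, Matrix.col_apply, testBit_colMask H j r r.2]
  rfl

end Columns

end Summit.Ventures.QEC.Census
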